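import Summits.QuantumFields.YangMills.Theorems.BalabanUVNodesN14LawChannelPushForward
import Summits.QuantumFields.YangMills.Theorems.BalabanUVNodesN19TiltPathMixture

/-!
# DAG node N14 (NE1′) — LENS control K12 ∘ K13: THE FINE-SPACE m-GEODESIC PUSHES FORWARD TO THE CLASS-SPACE m-GEODESIC EXACTLY
# (fibre log-MGF of the mixture exponent = class mixture exponent; conditioned direction = class direction; MASS letter equal, TV letter contracts)

Cell `pub-ymgap`, seat `pub-ymgap-dag-n14-c` (R134 (a) N14 NE1′ s1), generation 9; `--kind proof --supports stmt-QuantumFields-20509 --as helper` (K3⁶; helper, NOT a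
discharge).  Imports this lineage's K12 dictionary `…N14LawChannelPushForward` (p530910) and dag-n19-c's module V `…N19TiltPathMixture` (p534902: `mixture_aux`,
`exp_mixture_eq`, `integral_dir_mixture`, `osc_mixture_eq`, `exists_mixturePath` — CITED BY NAME, applied DOWNSTAIRS on the image law; nothing of V restated).  dag-n19-c
g17 ■ (bus l.20425) named this junction «the fine-space mixture path pushes forward to the class-space one under K12»; the K12 owner types it, asking nothing of N19.

SETTING.  Fine space `β` (standard Borel), class map `q : β → α` (measurable), run A's fine piece `ν` (finite, non-null, mass `m`), endpoint log-density `ψ₁` (`|ψ₁| ≤ M`),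
`Z = ∫e^{ψ₁}dν ∕ m`, `ρ = e^{ψ₁}∕Z`; downstairs (K12): image law `ν.map q` (mass `m`), FIBRE LOG-MGF `Λ₁ V = log ∫ e^{ψ₁} d(condLaw ν q V)`, class density `ρ_X = e^{Λ₁}∕Z`;
the m-geodesics (LENS (D3), n19-c V): fine `Φ_s = log((1−s) + s·ρ) + s·log Z`, `Φ′_s = (ρ−1)∕((1−s)+s·ρ) + log Z`; class `Φ^X_s`, `Φ^X′_s` (same formulas with `ρ_X`).
* §1 endpoint letters [folklore]: `real_map_univ`, `neZero_map`, `abs_fibreLogMGF_le` (`|Λ₁| ≤ M`), `exp_fibreLogMGF_eq`, ★ `classZ_eq` (the MASS letter `Z` is the SAME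
  downstairs — K12 `integral_fibreMGF_eq`), `classDensity_eq_condMean` (`ρ_X(V) = ∫ ρ d(condLaw V)`), `map_tilted_endpoint_eq` (K12a′ at the endpoint).
* §2 letters on `[0,1]` [folklore]: `mixtureWeight_mem`, `mixtureWeight_bounds`, `measurable_mixture`, `abs_mixture_le` (`|Φ_s| ≤ 3M`), `measurable_mixtureDir`,
  `abs_mixtureDir_le`, `classWeight_pos`, `integral_exp_mixture_condLaw` (`∫ e^{Φ_s} d(condLaw V) = ((1−s) + s·ρ_X(V))·e^{s·log Z}`).
* §3 ★★ THE DICTIONARY AND THE CALIBRATION COMMUTE [folklore]: ★ `fibreLogMGF_mixture_eq` (`log ∫ e^{Φ_s} d(condLaw V) = Φ^X_s(V)`: the K12 class exponent of the fine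
  m-geodesic IS the class m-geodesic), ★ `condDirection_mixture_eq` (`∫ Φ′_s d((condLaw V).tilted Φ_s) = Φ^X′_s(V)`: its K12 conditioned direction IS the class direction,
  EXACTLY), `map_tilted_mixture_eq` (`(ν.tilted Φ_s).map q = (ν.map q).tilted Φ^X_s`, K12a′).
* §4 CURRENCIES [folklore]: ★ `integral_abs_classDensity_sub_one_le` (`∫|ρ_X − 1| d(ν.map q) ≤ ∫|ρ − 1| dν`: TV CONTRACTS; fibrewise Jensen + the K12 §1 tower),
  `drift_classMixture_eq` (`= log Z`, V downstairs), `osc_classMixture_eq` (`= (1∕m)∫|ρ_X − 1|`, V downstairs), ★ `osc_classMixture_le_osc_mixture` (class OSC ≤ fine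
  OSC at every `s ∈ [0,1]` — K12d `condOsc_le_osc` READ ON the m-geodesic through §3).
* §5 ★★ `exists_classMixturePath` — V's `exists_mixturePath` DOWNSTAIRS at `(ν.map q, Λ₁)`: a class-space tilt path with road II∕III's everywhere-on-ℝ letters from
  `ν.map q` to `(ν.tilted ψ₁).map q = (ν.map q).tilted Λ₁`, DRIFT ≡ `log Z` (the FINE mass ratio), OSC ≡ `(1∕m)∫|ρ_X−1| d(ν.map q) ≤ (1∕m)∫|ρ−1| dν` on `[0,1]`.
READING (LENS control v6.2 (D2) + (D3) in one sentence): conditioning the m-geodesic gives the m-geodesic — dictionary K12 and calibration K13 COMMUTE, the MASS letter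
invariant, the TV letter never larger on the class space.  AT THE RECORD the fine-space TV is extensive (lens census V56), so §4's inequality is a CALIBRATION of
letters, NOT an estimate: the satisfiable statement remains the CLASS-space one (TV_cl ∕ SHAPE_cl on X, §N19), produced by nobody yet (NODE O ∕ NE5–NE7).
HONEST FRAMING.  [folklore] measure arithmetic on hypothesis shapes; nothing of Bałaban's; N14 ∕ N19 NOT discharged; K3⁶ NOT claimed; count-neutral; 0 `def`, 0 `sorry`.
One finite T⁴ programme at fixed ε — NOT continuum ∕ ℝ⁴ ∕ OS ∕ mass gap ∕ Clay.
-/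

noncomputable section

namespace YMDAG.N14.LawChannelPushForwardMixture

open MeasureTheory ProbabilityTheory Set Filter Topology
open scoped ENNReal NNReal
open Literature.MathematicalPhysics.QuantumFieldTheory.Balaban1983to89.T4AveragingDisintegration (condLaw)
open Literature.MathematicalPhysics.QuantumFieldTheory.Balaban1983to89.T4VarianceMatching.Tilt (integrable_exp_of_abs_le)
open Summit.QuantumFields.YangMills.BalabanUVNodes.N19TiltPathCalculus (integrable_of_abs_le)
open Summit.QuantumFields.YangMills.BalabanUVNodes.N19TiltPathMixture (mixture_aux exp_mixture_eq integral_dir_mixture osc_mixture_eq exists_mixturePath)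
open YMDAG.N14.LawChannelPushForward

variable {α β : Type*} [MeasurableSpace α] [MeasurableSpace β] [StandardBorelSpace β] [Nonempty β]
  (ν : Measure β) [IsFiniteMeasure ν] {q : β → α}
  {ψ₁ ρ : β → ℝ} {Λ₁ ρX : α → ℝ} {M Z : ℝ} {Φ Φ' : ℝ → β → ℝ} {ΦX ΦX' : ℝ → α → ℝ} {s : ℝ}

/-! ## §1 Class letters of the endpoint -/
section Endpoint

omit [StandardBorelSpace β] [Nonempty β] [IsFiniteMeasure ν] in
/-- The image law has the same mass. [folklore] -/
theorem real_map_univ (hq : Measurable q) : (ν.map q).real Set.univ = ν.real Set.univ := by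
  rw [measureReal_def, measureReal_def, Measure.map_apply hq MeasurableSet.univ, Set.preimage_univ]

omit [MeasurableSpace α] [MeasurableSpace β] [StandardBorelSpace β] [Nonempty β] [IsFiniteMeasure ν] in
/-- `e^{−K} ≤ x ≤ e^{K}` gives `|log x| ≤ K`. [folklore] -/
theorem abs_log_le_of_mem {x K : ℝ} (hlo : Real.exp (-K) ≤ x) (hhi : x ≤ Real.exp K) : |Real.log x| ≤ K :=
  abs_le.2 ⟨by simpa only [Real.log_exp] using Real.log_le_log (Real.exp_pos _) hlo,
    by simpa only [Real.log_exp] using Real.log_le_log ((Real.exp_pos _).trans_le hlo) hhi⟩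

/-- `e^{Λ₁(V)}` IS the fibre MGF. [folklore] -/
theorem exp_fibreLogMGF_eq (hψm : Measurable ψ₁) (hψb : ∀ U, |ψ₁ U| ≤ M)
    (hΛ : ∀ V, Λ₁ V = Real.log (∫ U, Real.exp (ψ₁ U) ∂(condLaw ν q V))) (V : α) :
    Real.exp (Λ₁ V) = ∫ U, Real.exp (ψ₁ U) ∂(condLaw ν q V) := by
  rw [hΛ V, Real.exp_log (fibreMGF_pos ν (q := q) hψm hψb V)]

/-- **THE CLASS LOG-DENSITY IS BOUNDED BY THE SAME `M`** (K12b′ at the endpoint): `|Λ₁| ≤ M`. [folklore] -/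
theorem abs_fibreLogMGF_le (hψm : Measurable ψ₁) (hψb : ∀ U, |ψ₁ U| ≤ M)
    (hΛ : ∀ V, Λ₁ V = Real.log (∫ U, Real.exp (ψ₁ U) ∂(condLaw ν q V))) (V : α) : |Λ₁ V| ≤ M := by
  obtain ⟨hlo, hhi⟩ := fibreMGF_mem_Icc ν (q := q) hψm hψb V
  rw [hΛ V]; exact abs_log_le_of_mem hlo hhi

/-- ★ **THE MASS LETTER IS INVARIANT UNDER THE CLASS MAP**: the normalised mass ratio of the image pieces equals the fine one,
`Z = ∫ e^{Λ₁} d(ν.map q) ∕ (ν.map q)(univ)` (K12 `integral_fibreMGF_eq`: the fibre MGF integrates to `∫e^{ψ₁}dν`).  Stated in module V's letter `hZ`, downstairs. [folklore] -/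
theorem classZ_eq (hq : Measurable q) (hψm : Measurable ψ₁) (hψb : ∀ U, |ψ₁ U| ≤ M)
    (hZ : Z = (∫ U, Real.exp (ψ₁ U) ∂ν) / ν.real Set.univ)
    (hΛ : ∀ V, Λ₁ V = Real.log (∫ U, Real.exp (ψ₁ U) ∂(condLaw ν q V))) :
    Z = (∫ V, Real.exp (Λ₁ V) ∂(ν.map q)) / (ν.map q).real Set.univ := by
  rw [real_map_univ ν hq, hZ, ← integral_fibreMGF_eq ν hq hψm hψb]
  congr 1
  exact integral_congr_ae (Eventually.of_forall fun V => (exp_fibreLogMGF_eq ν hψm hψb hΛ V).symm)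

/-- **THE CLASS DENSITY IS THE CONDITIONED DENSITY**: `ρ_X(V) = ∫ ρ d(condLaw ν q V)`. [folklore] -/
theorem classDensity_eq_condMean (hψm : Measurable ψ₁) (hψb : ∀ U, |ψ₁ U| ≤ M) (hρ : ∀ U, ρ U = Real.exp (ψ₁ U) / Z)
    (hΛ : ∀ V, Λ₁ V = Real.log (∫ U, Real.exp (ψ₁ U) ∂(condLaw ν q V))) (hρX : ∀ V, ρX V = Real.exp (Λ₁ V) / Z) (V : α) :
    ρX V = ∫ U, ρ U ∂(condLaw ν q V) := by
  rw [hρX V, exp_fibreLogMGF_eq ν hψm hψb hΛ V]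
  simp_rw [hρ]
  rw [integral_div]

/-- **THE ENDPOINTS OF THE CLASS PATH ARE THE IMAGES OF THE FINE ENDPOINT LAWS** (K12a′ at the endpoint): `(ν.tilted ψ₁).map q = (ν.map q).tilted Λ₁`
(and trivially `ν.map q` at the start). [folklore] -/
theorem map_tilted_endpoint_eq (hq : Measurable q) (hψm : Measurable ψ₁) (hψb : ∀ U, |ψ₁ U| ≤ M)
    (hΛ : ∀ V, Λ₁ V = Real.log (∫ U, Real.exp (ψ₁ U) ∂(condLaw ν q V))) :
    (ν.tilted ψ₁).map q = (ν.map q).tilted Λ₁ :=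
  map_tilted_eq_tilted_fibreLogMGF ν hq hψm hψb hΛ

end Endpoint

/-! ## §2 Letters of the fine m-geodesic on `[0,1]` -/
section Letters

variable [NeZero ν]

omit [StandardBorelSpace β] [Nonempty β] [IsFiniteMeasure ν] in
/-- The image of a non-null law is non-null. [folklore] -/
theorem neZero_map (hq : Measurable q) : NeZero (ν.map q) := by
  refine ⟨fun h => (NeZero.ne ν) ?_⟩
  rw [← Measure.measure_univ_eq_zero] at h ⊢
  rwa [Measure.map_apply hq MeasurableSet.univ, Set.preimage_univ] at h

omit [MeasurableSpace α] [MeasurableSpace β] [StandardBorelSpace β] [Nonempty β] in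
/-- On `[0,1]` the mixture weight is a convex combination of `1` and `a ∈ [L, H]` (`L ≤ 1 ≤ H`), so it lies in `[L, H]`. [folklore] -/
theorem mixtureWeight_mem {a L H : ℝ} (hs : s ∈ Icc (0 : ℝ) 1) (hL : L ≤ 1) (hH : 1 ≤ H) (ha : L ≤ a ∧ a ≤ H) :
    L ≤ (1 - s) + s * a ∧ (1 - s) + s * a ≤ H := by
  obtain ⟨hs0, hs1⟩ := hs; obtain ⟨haL, haH⟩ := ha; constructor <;> nlinarith

omit [StandardBorelSpace β] [Nonempty β] in
/-- The fine weight on `[0,1]`: `e^{−2M} ≤ (1−s) + s·ρ ≤ e^{2M}`, hence positive. [folklore] -/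
theorem mixtureWeight_bounds (hψm : Measurable ψ₁) (hψb : ∀ U, |ψ₁ U| ≤ M) (hZ : Z = (∫ U, Real.exp (ψ₁ U) ∂ν) / ν.real Set.univ)
    (hρ : ∀ U, ρ U = Real.exp (ψ₁ U) / Z) (hs : s ∈ Icc (0 : ℝ) 1) (U : β) :
    Real.exp (-(2 * M)) ≤ (1 - s) + s * ρ U ∧ (1 - s) + s * ρ U ≤ Real.exp (2 * M) ∧ 0 < (1 - s) + s * ρ U := by
  obtain ⟨-, -, -, -, hρb, -⟩ := mixture_aux hψm hψb hZ hρ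
  have hM0 : 0 ≤ M := (abs_nonneg _).trans (hψb U)
  have hL : Real.exp (-(2 * M)) ≤ 1 := Real.exp_le_one_iff.2 (by linarith)
  have hH : 1 ≤ Real.exp (2 * M) := Real.one_le_exp_iff.2 (by linarith)
  obtain ⟨h1, h2⟩ := mixtureWeight_mem hs hL hH (hρb U)
  exact ⟨h1, h2, (Real.exp_pos _).trans_le h1⟩

omit [StandardBorelSpace β] [Nonempty β] in
/-- The fine m-geodesic exponent is measurable. [folklore] -/
theorem measurable_mixture (hψm : Measurable ψ₁) (hψb : ∀ U, |ψ₁ U| ≤ M) (hZ : Z = (∫ U, Real.exp (ψ₁ U) ∂ν) / ν.real Set.univ)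
    (hρ : ∀ U, ρ U = Real.exp (ψ₁ U) / Z) (hΦ : ∀ s U, Φ s U = Real.log ((1 - s) + s * ρ U) + s * Real.log Z) (s : ℝ) :
    Measurable (Φ s) := by
  obtain ⟨-, -, -, -, -, hρm, -⟩ := mixture_aux hψm hψb hZ hρ
  have e : Φ s = fun U => Real.log ((1 - s) + s * ρ U) + s * Real.log Z := funext (hΦ s)
  rw [e]
  exact ((measurable_const.add (measurable_const.mul hρm)).log).add measurable_const

omit [StandardBorelSpace β] [Nonempty β] in
/-- The fine m-geodesic exponent is bounded on `[0,1]`: `|Φ_s| ≤ 3M` (`|log w| ≤ 2M`, `|s·log Z| ≤ M`). [folklore] -/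
theorem abs_mixture_le (hψm : Measurable ψ₁) (hψb : ∀ U, |ψ₁ U| ≤ M) (hZ : Z = (∫ U, Real.exp (ψ₁ U) ∂ν) / ν.real Set.univ)
    (hρ : ∀ U, ρ U = Real.exp (ψ₁ U) / Z) (hΦ : ∀ s U, Φ s U = Real.log ((1 - s) + s * ρ U) + s * Real.log Z) (hs : s ∈ Icc (0 : ℝ) 1)
    (U : β) : |Φ s U| ≤ 3 * M := by
  obtain ⟨-, -, hZlo, hZhi, -⟩ := mixture_aux hψm hψb hZ hρ
  obtain ⟨hwlo, hwhi, -⟩ := mixtureWeight_bounds ν hψm hψb hZ hρ hs U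
  have hlogZ : |Real.log Z| ≤ M := abs_log_le_of_mem hZlo hZhi
  have hlogw : |Real.log ((1 - s) + s * ρ U)| ≤ 2 * M := abs_log_le_of_mem hwlo hwhi
  have hsZ : |s * Real.log Z| ≤ M := by
    rw [abs_mul, abs_of_nonneg hs.1]; nlinarith [abs_nonneg (Real.log Z), hs.1, hs.2]
  rw [hΦ s U]
  calc |Real.log ((1 - s) + s * ρ U) + s * Real.log Z| ≤ |Real.log ((1 - s) + s * ρ U)| + |s * Real.log Z| := abs_add_le _ _
    _ ≤ 2 * M + M := add_le_add hlogw hsZ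
    _ = 3 * M := by ring

omit [StandardBorelSpace β] [Nonempty β] in
/-- The fine m-geodesic direction is measurable. [folklore] -/
theorem measurable_mixtureDir (hψm : Measurable ψ₁) (hψb : ∀ U, |ψ₁ U| ≤ M) (hZ : Z = (∫ U, Real.exp (ψ₁ U) ∂ν) / ν.real Set.univ)
    (hρ : ∀ U, ρ U = Real.exp (ψ₁ U) / Z) (hΦ' : ∀ s U, Φ' s U = (ρ U - 1) / ((1 - s) + s * ρ U) + Real.log Z) (s : ℝ) :
    Measurable (Φ' s) := by
  obtain ⟨-, -, -, -, -, hρm, -⟩ := mixture_aux hψm hψb hZ hρ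
  have e : Φ' s = fun U => (ρ U - 1) / ((1 - s) + s * ρ U) + Real.log Z := funext (hΦ' s)
  rw [e]
  exact ((hρm.sub measurable_const).div (measurable_const.add (measurable_const.mul hρm))).add measurable_const

omit [StandardBorelSpace β] [Nonempty β] in
/-- The fine m-geodesic direction is bounded on `[0,1]`: `|Φ′_s| ≤ (e^{2M} + 1)·e^{2M} + M`. [folklore] -/
theorem abs_mixtureDir_le (hψm : Measurable ψ₁) (hψb : ∀ U, |ψ₁ U| ≤ M) (hZ : Z = (∫ U, Real.exp (ψ₁ U) ∂ν) / ν.real Set.univ)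
    (hρ : ∀ U, ρ U = Real.exp (ψ₁ U) / Z) (hΦ' : ∀ s U, Φ' s U = (ρ U - 1) / ((1 - s) + s * ρ U) + Real.log Z) (hs : s ∈ Icc (0 : ℝ) 1)
    (U : β) : |Φ' s U| ≤ (Real.exp (2 * M) + 1) * Real.exp (2 * M) + M := by
  obtain ⟨-, -, hZlo, hZhi, hρb, -⟩ := mixture_aux hψm hψb hZ hρ
  obtain ⟨hwlo, -, hwpos⟩ := mixtureWeight_bounds ν hψm hψb hZ hρ hs U
  have hlogZ : |Real.log Z| ≤ M := abs_log_le_of_mem hZlo hZhi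
  have hnum : |ρ U - 1| ≤ Real.exp (2 * M) + 1 := by
    have := hρb U
    rw [abs_le]; constructor <;> linarith [Real.exp_pos (-(2 * M))]
  have hfrac : |(ρ U - 1) / ((1 - s) + s * ρ U)| ≤ (Real.exp (2 * M) + 1) * Real.exp (2 * M) := by
    rw [abs_div, abs_of_pos hwpos, div_le_iff₀ hwpos]
    have hE : Real.exp (2 * M) * Real.exp (-(2 * M)) = 1 := by rw [← Real.exp_add]; norm_num
    calc |ρ U - 1| ≤ (Real.exp (2 * M) + 1) * 1 := by rw [mul_one]; exact hnum
      _ = (Real.exp (2 * M) + 1) * Real.exp (2 * M) * Real.exp (-(2 * M)) := by rw [mul_assoc, hE]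
      _ ≤ (Real.exp (2 * M) + 1) * Real.exp (2 * M) * ((1 - s) + s * ρ U) :=
          mul_le_mul_of_nonneg_left hwlo (by positivity)
  rw [hΦ' s U]
  exact (abs_add_le _ _).trans (add_le_add hfrac hlogZ)

/-- The class density is a fibre average of `ρ` (`classDensity_eq_condMean`), so `e^{−2M} ≤ ρ_X ≤ e^{2M}` and the class weight is positive on `[0,1]`. [folklore] -/
theorem classWeight_pos (hψm : Measurable ψ₁) (hψb : ∀ U, |ψ₁ U| ≤ M) (hZ : Z = (∫ U, Real.exp (ψ₁ U) ∂ν) / ν.real Set.univ)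
    (hρ : ∀ U, ρ U = Real.exp (ψ₁ U) / Z) (hΛ : ∀ V, Λ₁ V = Real.log (∫ U, Real.exp (ψ₁ U) ∂(condLaw ν q V)))
    (hρX : ∀ V, ρX V = Real.exp (Λ₁ V) / Z) (hs : s ∈ Icc (0 : ℝ) 1) (V : α) :
    (Real.exp (-(2 * M)) ≤ ρX V ∧ ρX V ≤ Real.exp (2 * M)) ∧ 0 < (1 - s) + s * ρX V := by
  obtain ⟨-, -, -, -, hρb, hρm, -⟩ := mixture_aux hψm hψb hZ hρ
  have hρi : Integrable ρ (condLaw ν q V) :=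
    integrable_of_abs_le hρm fun U => by rw [abs_of_nonneg ((Real.exp_pos _).le.trans (hρb U).1)]; exact (hρb U).2
  have hρXb : Real.exp (-(2 * M)) ≤ ρX V ∧ ρX V ≤ Real.exp (2 * M) := by
    rw [classDensity_eq_condMean ν hψm hψb hρ hΛ hρX V]
    exact ⟨by simpa using integral_mono (integrable_const _) hρi fun U => (hρb U).1,
      by simpa using integral_mono hρi (integrable_const _) fun U => (hρb U).2⟩
  have hM0 : 0 ≤ M := (abs_nonneg _).trans (hψb (Classical.arbitrary β))
  have hL : Real.exp (-(2 * M)) ≤ 1 := Real.exp_le_one_iff.2 (by linarith)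
  have hH : 1 ≤ Real.exp (2 * M) := Real.one_le_exp_iff.2 (by linarith)
  exact ⟨hρXb, (Real.exp_pos _).trans_le (mixtureWeight_mem hs hL hH hρXb).1⟩

/-- **THE FIBRE MGF OF THE MIXTURE EXPONENT**: `∫ e^{Φ_s} d(condLaw ν q V) = ((1−s) + s·ρ_X(V))·e^{s·log Z}` on `[0,1]` (V's `exp_mixture_eq` fibrewise on the
probability measure `condLaw ν q V`, then `ρ_X(V) = ∫ρ d(condLaw V)`). [folklore] -/
theorem integral_exp_mixture_condLaw (hψm : Measurable ψ₁) (hψb : ∀ U, |ψ₁ U| ≤ M) (hZ : Z = (∫ U, Real.exp (ψ₁ U) ∂ν) / ν.real Set.univ)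
    (hρ : ∀ U, ρ U = Real.exp (ψ₁ U) / Z) (hΛ : ∀ V, Λ₁ V = Real.log (∫ U, Real.exp (ψ₁ U) ∂(condLaw ν q V)))
    (hρX : ∀ V, ρX V = Real.exp (Λ₁ V) / Z) (hΦ : ∀ s U, Φ s U = Real.log ((1 - s) + s * ρ U) + s * Real.log Z)
    (hs : s ∈ Icc (0 : ℝ) 1) (V : α) :
    ∫ U, Real.exp (Φ s U) ∂(condLaw ν q V) = ((1 - s) + s * ρX V) * Real.exp (s * Real.log Z) := by
  obtain ⟨-, -, -, -, hρb, hρm, -⟩ := mixture_aux hψm hψb hZ hρ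
  have hρi : Integrable ρ (condLaw ν q V) :=
    integrable_of_abs_le hρm fun U => by rw [abs_of_nonneg ((Real.exp_pos _).le.trans (hρb U).1)]; exact (hρb U).2
  have e : (fun U => Real.exp (Φ s U)) = fun U => Real.exp (s * Real.log Z) * s * ρ U + Real.exp (s * Real.log Z) * (1 - s) :=
    funext fun U => by rw [exp_mixture_eq hΦ (mixtureWeight_bounds ν hψm hψb hZ hρ hs U).2.2]; ring
  rw [e, integral_add (hρi.const_mul _) (integrable_const _), integral_const_mul, integral_const, smul_eq_mul, probReal_univ,
    ← classDensity_eq_condMean ν hψm hψb hρ hΛ hρX V]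
  ring

end Letters

/-! ## §3 The dictionary and the calibration commute -/
section Commute

variable [NeZero ν]

/-- ★ **THE K12 CLASS EXPONENT OF THE FINE m-GEODESIC IS THE CLASS m-GEODESIC**: `log ∫ e^{Φ_s} d(condLaw ν q V) = Φ^X_s(V) = log((1−s) + s·ρ_X(V)) + s·log Z` on
`[0,1]`. [folklore] -/
theorem fibreLogMGF_mixture_eq (hψm : Measurable ψ₁) (hψb : ∀ U, |ψ₁ U| ≤ M) (hZ : Z = (∫ U, Real.exp (ψ₁ U) ∂ν) / ν.real Set.univ)
    (hρ : ∀ U, ρ U = Real.exp (ψ₁ U) / Z) (hΛ : ∀ V, Λ₁ V = Real.log (∫ U, Real.exp (ψ₁ U) ∂(condLaw ν q V)))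
    (hρX : ∀ V, ρX V = Real.exp (Λ₁ V) / Z) (hΦ : ∀ s U, Φ s U = Real.log ((1 - s) + s * ρ U) + s * Real.log Z)
    (hΦX : ∀ s V, ΦX s V = Real.log ((1 - s) + s * ρX V) + s * Real.log Z) (hs : s ∈ Icc (0 : ℝ) 1) (V : α) :
    Real.log (∫ U, Real.exp (Φ s U) ∂(condLaw ν q V)) = ΦX s V := by
  have hwX := (classWeight_pos ν hψm hψb hZ hρ hΛ hρX hs V).2
  rw [integral_exp_mixture_condLaw ν hψm hψb hZ hρ hΛ hρX hΦ hs V, Real.log_mul hwX.ne' (Real.exp_pos _).ne', Real.log_exp, hΦX s V]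

/-- ★ **THE K12 CONDITIONED DIRECTION OF THE FINE m-GEODESIC IS THE CLASS DIRECTION**: `∫ Φ′_s d((condLaw ν q V).tilted Φ_s) = Φ^X′_s(V) =
(ρ_X(V) − 1)∕((1−s) + s·ρ_X(V)) + log Z` on `[0,1]` — EXACTLY, no inequality. [folklore] -/
theorem condDirection_mixture_eq (hψm : Measurable ψ₁) (hψb : ∀ U, |ψ₁ U| ≤ M) (hZ : Z = (∫ U, Real.exp (ψ₁ U) ∂ν) / ν.real Set.univ)
    (hρ : ∀ U, ρ U = Real.exp (ψ₁ U) / Z) (hΛ : ∀ V, Λ₁ V = Real.log (∫ U, Real.exp (ψ₁ U) ∂(condLaw ν q V)))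
    (hρX : ∀ V, ρX V = Real.exp (Λ₁ V) / Z) (hΦ : ∀ s U, Φ s U = Real.log ((1 - s) + s * ρ U) + s * Real.log Z)
    (hΦ' : ∀ s U, Φ' s U = (ρ U - 1) / ((1 - s) + s * ρ U) + Real.log Z)
    (hΦX' : ∀ s V, ΦX' s V = (ρX V - 1) / ((1 - s) + s * ρX V) + Real.log Z) (hs : s ∈ Icc (0 : ℝ) 1) (V : α) :
    ∫ U, Φ' s U ∂((condLaw ν q V).tilted (Φ s)) = ΦX' s V := by
  obtain ⟨-, -, -, -, hρb, hρm, -⟩ := mixture_aux hψm hψb hZ hρ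
  have hρi : Integrable ρ (condLaw ν q V) :=
    integrable_of_abs_le hρm fun U => by rw [abs_of_nonneg ((Real.exp_pos _).le.trans (hρb U).1)]; exact (hρb U).2
  have hwX := (classWeight_pos ν hψm hψb hZ hρ hΛ hρX hs V).2
  set wX : ℝ := (1 - s) + s * ρX V with hwXdef
  set E : ℝ := Real.exp (s * Real.log Z) with hEdef
  have hE : E ≠ 0 := (Real.exp_pos _).ne'
  rw [integral_tilted, integral_exp_mixture_condLaw ν hψm hψb hZ hρ hΛ hρX hΦ hs V]
  -- pointwise: the normalised integrand is affine in `ρ`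
  have e : (fun U => (Real.exp (Φ s U) / (wX * E)) • Φ' s U) =
      fun U => (1 + s * Real.log Z) / wX * ρ U + ((1 - s) * Real.log Z - 1) / wX := by
    funext U
    have hw : 0 < (1 - s) + s * ρ U := (mixtureWeight_bounds ν hψm hψb hZ hρ hs U).2.2
    rw [exp_mixture_eq hΦ hw, hΦ' s U, smul_eq_mul, ← hEdef]
    field_simp
    ring
  rw [e, integral_add (hρi.const_mul _) (integrable_const _), integral_const_mul, integral_const, smul_eq_mul, probReal_univ,
    ← classDensity_eq_condMean ν hψm hψb hρ hΛ hρX V, hΦX' s V, ← hwXdef]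
  field_simp
  ring

/-- **THE FINE m-GEODESIC PUSHES FORWARD TO THE CLASS m-GEODESIC** (K12a′ + `fibreLogMGF_mixture_eq`): `(ν.tilted Φ_s).map q = (ν.map q).tilted Φ^X_s` on `[0,1]`.
[folklore] -/
theorem map_tilted_mixture_eq (hq : Measurable q) (hψm : Measurable ψ₁) (hψb : ∀ U, |ψ₁ U| ≤ M)
    (hZ : Z = (∫ U, Real.exp (ψ₁ U) ∂ν) / ν.real Set.univ) (hρ : ∀ U, ρ U = Real.exp (ψ₁ U) / Z)
    (hΛ : ∀ V, Λ₁ V = Real.log (∫ U, Real.exp (ψ₁ U) ∂(condLaw ν q V))) (hρX : ∀ V, ρX V = Real.exp (Λ₁ V) / Z)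
    (hΦ : ∀ s U, Φ s U = Real.log ((1 - s) + s * ρ U) + s * Real.log Z)
    (hΦX : ∀ s V, ΦX s V = Real.log ((1 - s) + s * ρX V) + s * Real.log Z) (hs : s ∈ Icc (0 : ℝ) 1) :
    (ν.tilted (Φ s)).map q = (ν.map q).tilted (ΦX s) :=
  map_tilted_eq_tilted_fibreLogMGF ν hq (measurable_mixture ν hψm hψb hZ hρ hΦ s) (abs_mixture_le ν hψm hψb hZ hρ hΦ hs)
    fun V => (fibreLogMGF_mixture_eq ν hψm hψb hZ hρ hΛ hρX hΦ hΦX hs V).symm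

end Commute

/-! ## §4 Currencies: MASS equal, TV contracts; DRIFT equal, OSC never larger downstairs -/
section Currencies

variable [NeZero ν]

/-- ★ **TOTAL VARIATION CONTRACTS UNDER THE CLASS MAP**: `∫ |ρ_X − 1| d(ν.map q) ≤ ∫ |ρ − 1| dν` — fibrewise `|∫(ρ−1) d(condLaw V)| ≤ ∫|ρ−1| d(condLaw V)` and the
K12 §1 tower `∫_V ∫ · d(condLaw V) d(ν.map q) = ∫ · dν`. [folklore] -/
theorem integral_abs_classDensity_sub_one_le (hq : Measurable q) (hψm : Measurable ψ₁) (hψb : ∀ U, |ψ₁ U| ≤ M)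
    (hZ : Z = (∫ U, Real.exp (ψ₁ U) ∂ν) / ν.real Set.univ) (hρ : ∀ U, ρ U = Real.exp (ψ₁ U) / Z)
    (hΛ : ∀ V, Λ₁ V = Real.log (∫ U, Real.exp (ψ₁ U) ∂(condLaw ν q V))) (hρX : ∀ V, ρX V = Real.exp (Λ₁ V) / Z) :
    ∫ V, |ρX V - 1| ∂(ν.map q) ≤ ∫ U, |ρ U - 1| ∂ν := by
  obtain ⟨-, -, -, -, hρb, hρm, hρi, -⟩ := mixture_aux hψm hψb hZ hρ
  have hgm : Measurable fun U => |ρ U - 1| := (hρm.sub measurable_const).abs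
  have hgb' : ∀ U, |ρ U - 1| ≤ Real.exp (2 * M) + 1 := fun U => by
    have := hρb U
    rw [abs_le]; constructor <;> linarith [Real.exp_pos (-(2 * M))]
  have hgb : ∀ U, |(fun U => |ρ U - 1|) U| ≤ Real.exp (2 * M) + 1 := fun U => by
    simp only [abs_abs]; exact hgb' U
  have hgi : Integrable (fun U => |ρ U - 1|) ν := integrable_of_abs_le hgm hgb
  rw [integral_eq_integral_condLaw ν hq hgi]
  refine integral_mono_of_nonneg (Eventually.of_forall fun V => abs_nonneg _) ?_ (Eventually.of_forall fun V => ?_)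
  · exact integrable_of_abs_le (measurable_integral_condLaw ν hgm) fun V => by
      rw [abs_of_nonneg (integral_nonneg fun U => abs_nonneg _)]
      have := integral_mono (μ := condLaw ν q V) (integrable_of_abs_le hgm hgb) (integrable_const _) fun U => hgb' U
      simpa only [integral_const, smul_eq_mul, probReal_univ, one_mul] using this
  · have hρiV : Integrable ρ (condLaw ν q V) :=
      integrable_of_abs_le hρm fun U => by rw [abs_of_nonneg ((Real.exp_pos _).le.trans (hρb U).1)]; exact (hρb U).2
    show |ρX V - 1| ≤ ∫ U, |ρ U - 1| ∂(condLaw ν q V)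
    have e : ρX V - 1 = ∫ U, (ρ U - 1) ∂(condLaw ν q V) := by
      rw [integral_sub hρiV (integrable_const 1), integral_const, smul_eq_mul, probReal_univ, one_mul,
        classDensity_eq_condMean ν hψm hψb hρ hΛ hρX V]
    rw [e]
    exact abs_integral_le_integral_abs

/-- **DRIFT OF THE CLASS m-GEODESIC = `log Z` = DRIFT OF THE FINE ONE** (V's `integral_dir_mixture`, DOWNSTAIRS: its letters `hZ`∕`hρ` are `classZ_eq`∕`hρX`). [folklore] -/
theorem drift_classMixture_eq (hq : Measurable q) (hψm : Measurable ψ₁) (hψb : ∀ U, |ψ₁ U| ≤ M)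
    (hZ : Z = (∫ U, Real.exp (ψ₁ U) ∂ν) / ν.real Set.univ)
    (hΛ : ∀ V, Λ₁ V = Real.log (∫ U, Real.exp (ψ₁ U) ∂(condLaw ν q V))) (hρX : ∀ V, ρX V = Real.exp (Λ₁ V) / Z)
    (hΦX : ∀ s V, ΦX s V = Real.log ((1 - s) + s * ρX V) + s * Real.log Z)
    (hΦX' : ∀ s V, ΦX' s V = (ρX V - 1) / ((1 - s) + s * ρX V) + Real.log Z) (hs : s ∈ Icc (0 : ℝ) 1) :
    ∫ V, ΦX' s V ∂((ν.map q).tilted (ΦX s)) = Real.log Z := by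
  haveI := neZero_map ν hq
  have hΛm := measurable_fibreLogMGF ν hψm hΛ
  have hΛb := abs_fibreLogMGF_le ν hψm hψb hΛ
  have hZX := classZ_eq ν hq hψm hψb hZ hΛ
  exact integral_dir_mixture (μ := ν.map q) hΛm hΛb hZX hρX hΦX hΦX'
    fun V => (mixtureWeight_bounds (ν.map q) hΛm hΛb hZX hρX hs V).2.2

/-- **OSCILLATION OF THE CLASS m-GEODESIC = `(1∕m)∫|ρ_X − 1| d(ν.map q)`** — twice the TV distance of the normalised IMAGE laws (V's `osc_mixture_eq`, DOWNSTAIRS;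
the image mass is `m`). [folklore] -/
theorem osc_classMixture_eq (hq : Measurable q) (hψm : Measurable ψ₁) (hψb : ∀ U, |ψ₁ U| ≤ M)
    (hZ : Z = (∫ U, Real.exp (ψ₁ U) ∂ν) / ν.real Set.univ)
    (hΛ : ∀ V, Λ₁ V = Real.log (∫ U, Real.exp (ψ₁ U) ∂(condLaw ν q V))) (hρX : ∀ V, ρX V = Real.exp (Λ₁ V) / Z)
    (hΦX : ∀ s V, ΦX s V = Real.log ((1 - s) + s * ρX V) + s * Real.log Z)
    (hΦX' : ∀ s V, ΦX' s V = (ρX V - 1) / ((1 - s) + s * ρX V) + Real.log Z) (hs : s ∈ Icc (0 : ℝ) 1) :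
    ∫ V, |ΦX' s V - Real.log Z| ∂((ν.map q).tilted (ΦX s)) = (ν.real Set.univ)⁻¹ * ∫ V, |ρX V - 1| ∂(ν.map q) := by
  haveI := neZero_map ν hq
  have hΛm := measurable_fibreLogMGF ν hψm hΛ
  have hΛb := abs_fibreLogMGF_le ν hψm hψb hΛ
  have hZX := classZ_eq ν hq hψm hψb hZ hΛ
  rw [← real_map_univ ν hq]
  exact osc_mixture_eq (μ := ν.map q) hΛm hΛb hZX hρX hΦX hΦX'
    fun V => (mixtureWeight_bounds (ν.map q) hΛm hΛb hZX hρX hs V).2.2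

/-- ★ **CLASS OSC ≤ FINE OSC ALONG THE m-GEODESICS** — K12d `condOsc_le_osc` READ ON THE m-GEODESIC through §3: at every `s ∈ [0,1]`,
`∫ |Φ^X′_s − log Z| d((ν.map q).tilted Φ^X_s) ≤ ∫ |Φ′_s − log Z| d(ν.tilted Φ_s)` (= `(1∕m)∫|ρ_X−1| ≤ (1∕m)∫|ρ−1|` by `osc_classMixture_eq` ∕ V's `osc_mixture_eq`).
AT THE RECORD the right-hand side is extensive (lens V56): a calibration of letters, not an estimate. [folklore] -/
theorem osc_classMixture_le_osc_mixture (hq : Measurable q) (hψm : Measurable ψ₁) (hψb : ∀ U, |ψ₁ U| ≤ M)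
    (hZ : Z = (∫ U, Real.exp (ψ₁ U) ∂ν) / ν.real Set.univ) (hρ : ∀ U, ρ U = Real.exp (ψ₁ U) / Z)
    (hΛ : ∀ V, Λ₁ V = Real.log (∫ U, Real.exp (ψ₁ U) ∂(condLaw ν q V))) (hρX : ∀ V, ρX V = Real.exp (Λ₁ V) / Z)
    (hΦ : ∀ s U, Φ s U = Real.log ((1 - s) + s * ρ U) + s * Real.log Z)
    (hΦ' : ∀ s U, Φ' s U = (ρ U - 1) / ((1 - s) + s * ρ U) + Real.log Z)
    (hΦX : ∀ s V, ΦX s V = Real.log ((1 - s) + s * ρX V) + s * Real.log Z)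
    (hΦX' : ∀ s V, ΦX' s V = (ρX V - 1) / ((1 - s) + s * ρX V) + Real.log Z) (hs : s ∈ Icc (0 : ℝ) 1) :
    ∫ V, |ΦX' s V - Real.log Z| ∂((ν.map q).tilted (ΦX s)) ≤ ∫ U, |Φ' s U - Real.log Z| ∂(ν.tilted (Φ s)) := by
  rw [← map_tilted_mixture_eq ν hq hψm hψb hZ hρ hΛ hρX hΦ hΦX hs]
  exact condOsc_le_osc ν hq (measurable_mixture ν hψm hψb hZ hρ hΦ s) (abs_mixture_le ν hψm hψb hZ hρ hΦ hs)
    (measurable_mixtureDir ν hψm hψb hZ hρ hΦ' s) (abs_mixtureDir_le ν hψm hψb hZ hρ hΦ' hs)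
    (fun V => (condDirection_mixture_eq ν hψm hψb hZ hρ hΛ hρX hΦ hΦ' hΦX' hs V).symm) (Real.log Z)

end Currencies

/-! ## §5 The class-space mixture path with road II∕III's letters, from fine data -/
section Package

variable [NeZero ν]

/-- ★★ **THE CLASS m-GEODESIC AS A TILT PATH WITH ROAD II∕III's LETTERS, FROM FINE DATA** (V's `exists_mixturePath` DOWNSTAIRS at `(ν.map q, Λ₁)`): on the image law there is
a tilt path `ψ` (direction `ψ′`), measurable, pointwise C¹ ON ℝ, locally uniformly bounded, with `ψ 0 = 0` and `ψ 1 = Λ₁` — so it joins `ν.map q` to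
`(ν.tilted ψ₁).map q = (ν.map q).tilted Λ₁` (`map_tilted_endpoint_eq`) — along which, for every `u ∈ [0,1]`, DRIFT `≡ log Z` (the FINE normalised mass ratio,
`classZ_eq`) and OSC `≡ (1∕m)∫|ρ_X − 1| d(ν.map q) ≤ (1∕m)∫|ρ − 1| dν` (`integral_abs_classDensity_sub_one_le`). [folklore ∘ V ∘ §§1,4] -/
theorem exists_classMixturePath (hq : Measurable q) (hψm : Measurable ψ₁) (hψb : ∀ U, |ψ₁ U| ≤ M)
    (hZ : Z = (∫ U, Real.exp (ψ₁ U) ∂ν) / ν.real Set.univ) (hρ : ∀ U, ρ U = Real.exp (ψ₁ U) / Z)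
    (hΛ : ∀ V, Λ₁ V = Real.log (∫ U, Real.exp (ψ₁ U) ∂(condLaw ν q V))) (hρX : ∀ V, ρX V = Real.exp (Λ₁ V) / Z) :
    (ν.tilted ψ₁).map q = (ν.map q).tilted Λ₁ ∧
    ∃ ψ ψ' : ℝ → α → ℝ, (∀ u, Measurable (ψ u)) ∧ (∀ u, Measurable (ψ' u)) ∧ (∀ u V, HasDerivAt (fun v => ψ v V) (ψ' u V) u) ∧
      (∀ u₀ : ℝ, ∃ ε > 0, ∃ M' : ℝ, ∀ u ∈ Metric.ball u₀ ε, ∀ V, |ψ u V| ≤ M' ∧ |ψ' u V| ≤ M') ∧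
      (∀ V, ψ 0 V = 0) ∧ (∀ V, ψ 1 V = Λ₁ V) ∧
      (∀ u ∈ Icc (0 : ℝ) 1, ∫ V, ψ' u V ∂((ν.map q).tilted (ψ u)) = Real.log Z) ∧
      (∀ u ∈ Icc (0 : ℝ) 1, ∫ V, |ψ' u V - ∫ W, ψ' u W ∂((ν.map q).tilted (ψ u))| ∂((ν.map q).tilted (ψ u)) =
        (ν.real Set.univ)⁻¹ * ∫ V, |ρX V - 1| ∂(ν.map q)) ∧
      (ν.real Set.univ)⁻¹ * ∫ V, |ρX V - 1| ∂(ν.map q) ≤ (ν.real Set.univ)⁻¹ * ∫ U, |ρ U - 1| ∂ν := by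
  haveI := neZero_map ν hq
  have hΛm := measurable_fibreLogMGF ν hψm hΛ
  have hΛb := abs_fibreLogMGF_le ν hψm hψb hΛ
  have hZX := classZ_eq ν hq hψm hψb hZ hΛ
  obtain ⟨ψ, ψ', hm, hm', hd, hbd, h0, h1, hdrift, hosc⟩ := exists_mixturePath (μ := ν.map q) hΛm hΛb hZX hρX
  refine ⟨map_tilted_endpoint_eq ν hq hψm hψb hΛ, ψ, ψ', hm, hm', hd, hbd, h0, h1, hdrift, fun u hu => ?_, ?_⟩
  · rw [hosc u hu, real_map_univ ν hq]
  · exact mul_le_mul_of_nonneg_left (integral_abs_classDensity_sub_one_le ν hq hψm hψb hZ hρ hΛ hρX)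
      (inv_nonneg.2 measureReal_nonneg)

end Package

end YMDAG.N14.LawChannelPushForwardMixture

end
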